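import Summits.RiemannHypothesis.RiemannHypothesis.Theses.WeilComb
import Literature.NumberTheory.LFunctions.WeilArchimedeanMoments
import Literature.NumberTheory.LFunctions.ChebyshevPsiExplicitPartialRH
import Literature.NumberTheory.LFunctions.PsiTailIntegralExplicit
import Literature.NumberTheory.LFunctions.ZetaZeroTailSums
import Literature.NumberTheory.LFunctions.RiemannHypothesisUpTo2516
import Literature.NumberTheory.LFunctions.RosserSchoenfeldMertensFirstConstant

/-!
# Sketch (stub-ideation k=3, stub_windowCore of crux CombShapePositivity) — helper-lemma signatures only

Elaboration sanity for the Lean-typed helper statements of `STUB-IDEAS-stub_windowCore-3.md`.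
No proofs. Namespace is private to this sketch.
-/

noncomputable section

open scoped BigOperators ComplexConjugate Chebyshev
open Complex MeasureTheory

namespace Summit.RiemannHypothesis.RiemannHypothesis.Cruxes.CombShapePositivity.StubWindowCoreK3

open Literature.NumberTheory.LFunctions

/-- The registered stub's inequality as a predicate (verbatim body of `stub_windowCore`, incl. the
digamma factor that the 900-char payload signature truncates). -/
def CoreIneq (ε : ℝ) (M : ℕ) (a : ℕ → ℂ) : Prop :=
    ε⁻¹ * weilNorm2Sq (fun u : ℝ => ((expNegInvGlue (1 - u ^ 2) : ℝ) : ℂ)) *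
        (2 * (∑ m ∈ Finset.Icc 1 M, ∑ n ∈ Finset.Icc 1 (M / m),
            ((ArithmeticFunction.vonMangoldt n : ℝ) : ℂ) / (Real.sqrt n : ℂ) * a (n * m) *
              conj (a m)).re
          + Real.log Real.pi * ∑ m ∈ Finset.Icc 1 M, ‖a m‖ ^ 2) ≤
      2 * (weilMellin (fun t : ℝ => (ε : ℂ)⁻¹ * ((expNegInvGlue (1 - (t / ε) ^ 2) : ℝ) : ℂ)) 0 *
            conj (weilMellin (fun t : ℝ => (ε : ℂ)⁻¹ * ((expNegInvGlue (1 - (t / ε) ^ 2) : ℝ) : ℂ)) 1) *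
          ((∑ m ∈ Finset.Icc 1 M, a m * ((Real.sqrt (m : ℝ) : ℝ) : ℂ)⁻¹) *
            conj (∑ m ∈ Finset.Icc 1 M, a m * ((Real.sqrt (m : ℝ) : ℝ) : ℂ)))).re
      + 1 / (2 * Real.pi) * ∫ t : ℝ,
          ‖weilMellin (fun t : ℝ => (ε : ℂ)⁻¹ * ((expNegInvGlue (1 - (t / ε) ^ 2) : ℝ) : ℂ))
              (1 / 2 + t * I)‖ ^ 2 *
            ‖∑ m ∈ Finset.Icc 1 M, a m * cexp (t * I * (Real.log (m : ℝ) : ℂ))‖ ^ 2 *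
            (Complex.digamma (1 / 4 + t / 2 * I)).re

/-- Helson form `H(a)`, Dirichlet energy `D(a)`, mass `L(a)` (the lead's notation). -/
def helsonH (M : ℕ) (a : ℕ → ℂ) : ℝ :=
  2 * (∑ m ∈ Finset.Icc 1 M, ∑ n ∈ Finset.Icc 1 (M / m),
    ((ArithmeticFunction.vonMangoldt n : ℝ) : ℂ) / (Real.sqrt n : ℂ) * a (n * m) * conj (a m)).re

def dirichletD (M : ℕ) (a : ℕ → ℂ) : ℝ :=
  ∑ m ∈ Finset.Icc 1 M, ∑ n ∈ Finset.Icc 1 (M / m),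
    (ArithmeticFunction.vonMangoldt n : ℝ) * ‖a (n * m) - ((Real.sqrt (n : ℝ) : ℝ) : ℂ)⁻¹ * a m‖ ^ 2

def massL (M : ℕ) (a : ℕ → ℂ) : ℝ := ∑ m ∈ Finset.Icc 1 M, ‖a m‖ ^ 2

/-- `ψ₁(y) = Σ_{n ≤ y} Λ(n)/n`. -/
def psiOneHarm (y : ℝ) : ℝ := ∑ n ∈ Finset.Ioc 0 ⌊y⌋₊, (ArithmeticFunction.vonMangoldt n : ℝ) / n

/-- **L1 (MertensConst)** — constant-precision Mertens from the tree's 2000 certified zeros. -/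
def MertensConst : Prop := ∀ x : ℝ, 442439 ≤ x →
  |psiOneHarm x - Real.log x + Real.eulerMascheroniConstant| ≤ 1 / 50

/-- **L1′ (identity behind L1)** — Abel summation + `integral_Ioi_psi_sub_self_div_sq`. -/
def MertensIdentity : Prop := ∀ x : ℝ, 1 < x →
  psiOneHarm x = Real.log x - Real.eulerMascheroniConstant + (ψ x - x) / x
    - ∫ t in Set.Ioi x, (ψ t - t) / t ^ 2

/-- the two in-tree inputs of L1, instantiated (sanity that the names/types are as claimed) -/
example {x : ℝ} (hx : 9 ≤ x) : |ψ x - x| ≤ 0.00862 * x + 5.72 * Real.sqrt x + 1.838 :=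
  PsiFromZeros2516.abs_psi_sub_self_le hx
example {x : ℝ} (hx : 1 ≤ x) :
    PsiTailIntegral.rsK x ≤ x ^ (-(1 / 2 : ℝ)) * SchoenfeldBound.sumInvNormSq 2516
      + PsiTailIntegral.tailInvNormProd 2516 :=
  PsiTailIntegral.rsK_le_of_inStripUpTo riemannHypothesisInStripUpTo_2516 hx
example : PsiTailIntegral.tailInvNormProd 2516 ≤ 2 * SchoenfeldBound.Gtail 2516 :=
  ZetaZeroTails.tailInvNormProd_le le_rfl
example {x : ℝ} (hx : 1 < x) :
    |∫ t in Set.Ioi x, (ψ t - t) / t ^ 2| ≤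
      PsiTailIntegral.rsK x + Real.log (2 * Real.pi) / x + 1 / (2 * x * (x ^ 2 - 1)) :=
  PsiTailIntegral.abs_integral_Ioi_psi_sub_self_div_sq_le hx

/-- **L2 (HelsonPotentialSharp w)** — pointwise potential `V_m = log m + ψ₁(M/m)` against the sharp
constant, with an explicit nonnegative top-layer excess `w` (step function, `w y = 0` for `y ≥ 20`). -/
def HelsonPotentialSharp (w : ℝ → ℝ) : Prop := ∀ M : ℕ, 1 ≤ M → ∀ m ∈ Finset.Icc 1 M,
  Real.log m + psiOneHarm ((M : ℝ) / m) ≤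
    Real.log M - Real.eulerMascheroniConstant + 87 / 1000 + w ((M : ℝ) / m)

/-- **L3 (TopLayerTrace)** — the top-layer excess is paid by Dirichlet energy and `O(L/log M)`. -/
def TopLayerTrace (w : ℝ → ℝ) (M₀ : ℕ) (c₁ c₂ : ℝ) : Prop := ∀ M : ℕ, M₀ ≤ M → ∀ a : ℕ → ℂ,
  ∑ m ∈ Finset.Icc 1 M, w ((M : ℝ) / m) * ‖a m‖ ^ 2 ≤
    c₁ / Real.log M * dirichletD M a + c₂ / Real.log M * massL M a

/-- **Target of L1–L4 (HelsonSharp)** — replaces `stub_helsonG`'s `(log M + 39/50) L`: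
`H(a) ≤ (log M + G) L − κ D(a)` with `G ≈ −0.49 + 0.4/log M`, `κ ≈ 0.75`. -/
def HelsonSharp (M₀ : ℕ) (G κ : ℝ) : Prop := ∀ M : ℕ, M₀ ≤ M → ∀ a : ℕ → ℂ,
  helsonH M a ≤ (Real.log M + G) * massL M a - κ * dirichletD M a

/-- **L4 (HelsonSmallCertified)** — small `M` by a kernel-checked Collatz–Wielandt certificate. -/
def HelsonSmallCertified (M₀ : ℕ) (c : ℕ → ℝ) : Prop := ∀ M : ℕ, 2 ≤ M → M ≤ M₀ → ∀ a : ℕ → ℂ,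
  helsonH M a ≤ (Real.log M - c M) * massL M a

/-- **L5 (RealReduction)** — a minimal counterexample is real: all four blocks of `CoreIneq` are
Hermitian forms with real symmetric matrices. -/
def RealReduction : Prop := ∀ ε : ℝ, 0 < ε → ∀ M : ℕ,
  (∀ b : ℕ → ℝ, CoreIneq ε M (fun m => (b m : ℂ))) → ∀ a : ℕ → ℂ, CoreIneq ε M a

/-- **L6 (PoleEnergyRelaxed)** — pole paid by energy plus an `o(1)·L` dump (relaxed Thomson). -/
def PoleEnergyRelaxed (M₀ : ℕ) (c r : ℝ) : Prop := ∀ M : ℕ, M₀ ≤ M → ∀ a : ℕ → ℂ,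
  0 ≤ 2 * ((∑ m ∈ Finset.Icc 1 M, a m * ((Real.sqrt (m : ℝ) : ℝ) : ℂ)⁻¹) *
        conj (∑ m ∈ Finset.Icc 1 M, a m * ((Real.sqrt (m : ℝ) : ℝ) : ℂ))).re
      + c * M * dirichletD M a + r * (M / Real.log M) * massL M a

/-- the re-glue the plan recommends: Mid (provable path) + Top (residual) ⇒ the registered stub. -/
theorem windowCore_of_mid_top
    (hmid : ∀ ε : ℝ, 0 < ε → ∀ (M : ℕ) (a : ℕ → ℂ), 1 ≤ M → 1 / 40 < ε * M → ε * M ≤ 1 / 16 →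
      CoreIneq ε M a)
    (htop : ∀ ε : ℝ, 0 < ε → ∀ (M : ℕ) (a : ℕ → ℂ), 1 ≤ M → 1 / 16 < ε * M →
      2 * ε * ((M : ℝ) + 1) ≤ 1 → CoreIneq ε M a) :
    ∀ ε : ℝ, 0 < ε → ∀ (M : ℕ) (a : ℕ → ℂ), 1 ≤ M → 1 / 40 < ε * M →
      2 * ε * ((M : ℝ) + 1) ≤ 1 → CoreIneq ε M a := by
  intro ε hε M a hM hlo hw
  by_cases h : ε * M ≤ 1 / 16
  · exact hmid ε hε M a hM hlo h
  · exact htop ε hε M a hM (lt_of_not_ge h) hw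

end Summit.RiemannHypothesis.RiemannHypothesis.Cruxes.CombShapePositivity.StubWindowCoreK3

end
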